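import Mathlib
import HarnessLib
import Summits.AtomisticToContinuum.Crystallization.Theorems.FrustratedLawDichotomyAperiodicFrustratedLawGapErgodicMeanErgodic
import Summits.AtomisticToContinuum.Crystallization.Theorems.FrustratedLawDichotomyAperiodicFrustratedLawGapErgodicWeight
import Summits.AtomisticToContinuum.Crystallization.Theorems.FrustratedLawDichotomyAperiodicFrustratedLawGapErgodicPiSystem
import Summits.AtomisticToContinuum.Crystallization.Theorems.FrustratedLawDichotomyAperiodicFrustratedLawGapErgodicRestrict
import Summits.AtomisticToContinuum.Crystallization.Theorems.FrustratedLawDichotomyAperiodicFrustratedLawGapErgodicCriterion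

/-!
# Ergodic reduction for the crux `AperiodicFrustratedLawGap` — almost every conditional law is ergodic (step D5)

Route `FrustratedLawDichotomy`, crux `AperiodicFrustratedLawGap` (item `stmt-AtomisticToContinuum-27623`),
registered stub `stub_ergodicReduction` (skeleton `dd3251ad731e`); **step D5 = `hErg` closed** (S5 assembly of
the plan `D5-PLAN.md`): for every probability law `Q` on rooted `δ`-hard-core configurations of `ℝ³` whose
Campbell measure is invariant under the re-rooting involution, and for the σ-algebra `𝓘` of measurable
re-rooting-invariant sets, `Q`-almost every conditional law `condExpKernel Q 𝓘 ω` is TRIVIAL on every measurable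
re-rooting-invariant set ("ergodicity via conditioning", Farrell–Varadarajan; Kallenberg FMP3 Lemma 10.25 /
Thm 10.26, here for the re-rooting equivalence relation of point-stationary laws).

Assembly: the everywhere-positive weight (`…ErgodicWeight`), the countable generating π-system of configuration
sets (`…ErgodicPiSystem`), the mean ergodic theorem for the pointwise re-rooting averages applied to `Q` AND to
almost every conditional law (`…ErgodicMeanErgodic`, the latter being Campbell-invariant by
`…ErgodicCondKernel.ae_map_reroot_compProd_condExpKernel` + `…ErgodicRestrict`), fed into the generic criterion
`…ErgodicCriterion.ae_condExpKernel_trivial_of_tendsto`.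

* `ae_ergodic_condExpKernel` — the theorem (`[Fact (0 < δ)]` form);
* `aeErgodic_condExpKernel_hErg` — the same in the exact binder shape of the hypothesis `hErg` of
  `…ErgodicAssembly.ergodicReduction_of_aeErgodic`.

`[folklore]`.
-/

noncomputable section

namespace Summit.AtomisticToContinuum.Crystallization.Theorems.FrustratedLawDichotomyErgodicReduction

open MeasureTheory Set Filter ProbabilityTheory Topology
open scoped ENNReal Classical
open Literature.Probability.Process (LocalConfig)
open Literature.Probability.Process.LocalConfig (RootedHardCoreConfig toMeasure_def measurable_toMeasure)
open Summit.AtomisticToContinuum.Crystallization.Theorems.BenjaminiSchrammLimit (isSFiniteKernel_toMeasure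
  measurable_reroot)

variable {δ : ℝ}

/-- **Almost every conditional law given the invariant σ-algebra is ergodic** (`δ > 0`).  Let `Q` be a
probability law on rooted `δ`-hard-core configurations of `ℝ³` with Campbell measure invariant under the
re-rooting involution, and `𝓘 = ⟨m, hm⟩` a sub-σ-algebra whose events are exactly the measurable
re-rooting-invariant sets.  Then for `Q`-a.e. `ω`, the conditional law `condExpKernel Q m ω` gives measure `0`
to `B` or to `Bᶜ` for every measurable re-rooting-invariant `B`. [folklore] -/
theorem ae_ergodic_condExpKernel [Fact (0 < δ)]
    {Q : Measure (RootedHardCoreConfig (EuclideanSpace ℝ (Fin 3)) δ)} [IsProbabilityMeasure Q]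
    (hinv : haveI := isSFiniteKernel_toMeasure (E := EuclideanSpace ℝ (Fin 3)) (δ := δ)
      (Q ⊗ₘ (⟨fun S : RootedHardCoreConfig (EuclideanSpace ℝ (Fin 3)) δ =>
        (S.1 : LocalConfig (EuclideanSpace ℝ (Fin 3))).toMeasure,
        measurable_toMeasure (Fact.out : 0 < δ)⟩ :
        Kernel (RootedHardCoreConfig (EuclideanSpace ℝ (Fin 3)) δ) (EuclideanSpace ℝ (Fin 3)))).map
      (fun p : RootedHardCoreConfig (EuclideanSpace ℝ (Fin 3)) δ × EuclideanSpace ℝ (Fin 3) =>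
        ((if h : p.2 ∈ ((p.1.1 : LocalConfig (EuclideanSpace ℝ (Fin 3))) : Set (EuclideanSpace ℝ (Fin 3)))
          then p.1.reroot p.2 h else p.1 : RootedHardCoreConfig (EuclideanSpace ℝ (Fin 3)) δ), -p.2)) =
      Q ⊗ₘ (⟨fun S : RootedHardCoreConfig (EuclideanSpace ℝ (Fin 3)) δ =>
        (S.1 : LocalConfig (EuclideanSpace ℝ (Fin 3))).toMeasure,
        measurable_toMeasure (Fact.out : 0 < δ)⟩ :
        Kernel (RootedHardCoreConfig (EuclideanSpace ℝ (Fin 3)) δ) (EuclideanSpace ℝ (Fin 3))))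
    (𝓘 : {m : MeasurableSpace (RootedHardCoreConfig (EuclideanSpace ℝ (Fin 3)) δ) //
      m ≤ (Subtype.instMeasurableSpace : MeasurableSpace (RootedHardCoreConfig (EuclideanSpace ℝ (Fin 3)) δ))})
    (hmiff : ∀ B : Set (RootedHardCoreConfig (EuclideanSpace ℝ (Fin 3)) δ), MeasurableSet[𝓘.1] B ↔
      (MeasurableSet B ∧ (∀ (S : RootedHardCoreConfig (EuclideanSpace ℝ (Fin 3)) δ) (y : EuclideanSpace ℝ (Fin 3))
        (hy : y ∈ ((S.1 : LocalConfig (EuclideanSpace ℝ (Fin 3))) : Set (EuclideanSpace ℝ (Fin 3)))),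
        S ∈ B ↔ S.reroot y hy ∈ B))) :
    ∀ᵐ ω ∂Q, ∀ B : Set (RootedHardCoreConfig (EuclideanSpace ℝ (Fin 3)) δ), MeasurableSet B →
      (∀ (S : RootedHardCoreConfig (EuclideanSpace ℝ (Fin 3)) δ) (y : EuclideanSpace ℝ (Fin 3))
        (hy : y ∈ ((S.1 : LocalConfig (EuclideanSpace ℝ (Fin 3))) : Set (EuclideanSpace ℝ (Fin 3)))),
        S ∈ B ↔ S.reroot y hy ∈ B) →
      condExpKernel Q 𝓘.1 ω B = 0 ∨ condExpKernel Q 𝓘.1 ω Bᶜ = 0 := by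
  haveI := isSFiniteKernel_toMeasure (E := EuclideanSpace ℝ (Fin 3)) (δ := δ)
  have hδ : 0 < δ := Fact.out
  -- the weight, the π-system and an enumeration of it
  obtain ⟨w, hw, hws, hw0, -, hw1⟩ := exists_rerootWeight hδ
  obtain ⟨d, -, hdm, -, hdi, hgen⟩ := exists_piSystem_config (δ := δ)
  obtain ⟨e, he⟩ := exists_surjective_nat (Finset ℕ)
  have hrange : Set.range (fun j : ℕ => d (e j)) = Set.range d := he.range_comp d
  have hgen' : (inferInstance : MeasurableSpace (RootedHardCoreConfig (EuclideanSpace ℝ (Fin 3)) δ)) =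
      MeasurableSpace.generateFrom (Set.range fun j : ℕ => d (e j)) := by
    rw [hrange]; exact hgen
  have hpi : IsPiSystem (Set.range fun j : ℕ => d (e j)) := by
    rw [hrange]
    rintro _ ⟨F, rfl⟩ _ ⟨G, rfl⟩ -
    exact ⟨F ∪ G, (hdi F G).symm⟩
  -- the test functions `1_{d (e j)}`
  have hfm : ∀ j : ℕ, Measurable ((d (e j)).indicator fun _ => (1 : ℝ)) := fun j =>
    measurable_const.indicator (hdm (e j))
  have hfb : ∀ (j : ℕ) (S : RootedHardCoreConfig (EuclideanSpace ℝ (Fin 3)) δ),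
      ‖(d (e j)).indicator (fun _ => (1 : ℝ)) S‖ ≤ 1 := fun j S => by
    by_cases hS : S ∈ d (e j) <;> simp [hS]
  -- the pointwise lazy re-rooting average
  set A : (RootedHardCoreConfig (EuclideanSpace ℝ (Fin 3)) δ → ℝ) →
      (RootedHardCoreConfig (EuclideanSpace ℝ (Fin 3)) δ → ℝ) :=
    (fun (f : RootedHardCoreConfig (EuclideanSpace ℝ (Fin 3)) δ → ℝ)
      (S : RootedHardCoreConfig (EuclideanSpace ℝ (Fin 3)) δ) => ∫ y, f ((fun p : RootedHardCoreConfig (EuclideanSpace ℝ (Fin 3)) δ × EuclideanSpace ℝ (Fin 3) =>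
        ((if h : p.2 ∈ ((p.1.1 : LocalConfig (EuclideanSpace ℝ (Fin 3))) : Set (EuclideanSpace ℝ (Fin 3)))
          then p.1.reroot p.2 h else p.1 : RootedHardCoreConfig (EuclideanSpace ℝ (Fin 3)) δ), -p.2)) (S, y)).1 ∂((haveI := isSFiniteKernel_toMeasure (E := EuclideanSpace ℝ (Fin 3)) (δ := δ)
          Kernel.withDensity (⟨fun S : RootedHardCoreConfig (EuclideanSpace ℝ (Fin 3)) δ =>
        (S.1 : LocalConfig (EuclideanSpace ℝ (Fin 3))).toMeasure,
        measurable_toMeasure (Fact.out : 0 < δ)⟩ :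
        Kernel (RootedHardCoreConfig (EuclideanSpace ℝ (Fin 3)) δ) (EuclideanSpace ℝ (Fin 3)))
          (fun (S : RootedHardCoreConfig (EuclideanSpace ℝ (Fin 3)) δ) (y : EuclideanSpace ℝ (Fin 3)) =>
        w y + (1 - ∫⁻ z, w z ∂((S.1 : LocalConfig (EuclideanSpace ℝ (Fin 3))).toMeasure)) *
          ({(0 : EuclideanSpace ℝ (Fin 3))} : Set (EuclideanSpace ℝ (Fin 3))).indicator (fun _ => (1 : ℝ≥0∞)) y)) S))
    with hA_def
  -- measurability of the Cesàro averages
  have hu : ∀ j n : ℕ, Measurable (birkhoffAverage ℝ A _root_.id n ((d (e j)).indicator fun _ => (1 : ℝ))) := by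
    intro j n
    have hba : birkhoffAverage ℝ A _root_.id n ((d (e j)).indicator fun _ => (1 : ℝ)) =
        fun S => (n : ℝ)⁻¹ * ∑ k ∈ Finset.range n, (A^[k] ((d (e j)).indicator fun _ => (1 : ℝ))) S := by
      funext S
      simp only [birkhoffAverage, birkhoffSum, _root_.id, Pi.smul_apply, Finset.sum_apply, smul_eq_mul]
    rw [hba]
    exact (Finset.measurable_fun_sum _ fun k _ =>
      (measurable_iterate_rerootAverage_and_bound (δ := δ) hw hw1 (hfm j) (hfb j) k).1).const_mul _
  -- global Cesàro limits: the mean ergodic theorem for `Q`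
  choose v hvm hvinv _hv2 _hvI hvlim using
    fun j : ℕ => meanErgodic_rerootAverage (ν := Q) hinv hw hws hw0 hw1 (hfm j) (hfb j)
  have hvI : ∀ j : ℕ, Measurable[𝓘.1] (v j) := by
    intro j s hs
    exact (hmiff _).2 ⟨hvm j hs, fun S y hy => by rw [mem_preimage, mem_preimage, hvinv j S y hy]⟩
  -- almost every conditional law is Campbell-invariant
  have hres := fun (B : Set (RootedHardCoreConfig (EuclideanSpace ℝ (Fin 3)) δ))
      (hB : MeasurableSet[𝓘.1] B) =>
    map_reroot_compProd_restrict hinv ((hmiff B).1 hB).1 ((hmiff B).1 hB).2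
  have haeinv := ae_map_reroot_compProd_condExpKernel (Q := Q) 𝓘 hres
  -- local Cesàro limits: the mean ergodic theorem for almost every conditional law
  have hloc : ∀ᵐ ω ∂Q, ∀ j : ℕ, ∃ G : RootedHardCoreConfig (EuclideanSpace ℝ (Fin 3)) δ → ℝ, Measurable G ∧
      (∀ I : Set (RootedHardCoreConfig (EuclideanSpace ℝ (Fin 3)) δ), MeasurableSet I →
        (∀ (S : RootedHardCoreConfig (EuclideanSpace ℝ (Fin 3)) δ) (y : EuclideanSpace ℝ (Fin 3))
          (hy : y ∈ ((S.1 : LocalConfig (EuclideanSpace ℝ (Fin 3))) : Set (EuclideanSpace ℝ (Fin 3)))),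
          S ∈ I ↔ S.reroot y hy ∈ I) →
        ∫ x in I, G x ∂(condExpKernel Q 𝓘.1 ω) =
          ∫ x in I, (d (e j)).indicator (fun _ => (1 : ℝ)) x ∂(condExpKernel Q 𝓘.1 ω)) ∧
      Tendsto (fun n => eLpNorm (birkhoffAverage ℝ A _root_.id n ((d (e j)).indicator fun _ => (1 : ℝ)) - G) 2
        (condExpKernel Q 𝓘.1 ω)) atTop (𝓝 0) := by
    filter_upwards [haeinv] with ω hω
    intro j
    obtain ⟨G, hGm, -, -, hGI, hGlim⟩ :=
      meanErgodic_rerootAverage (ν := condExpKernel Q 𝓘.1 ω) hω hw hws hw0 hw1 (hfm j) (hfb j)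
    exact ⟨G, hGm, hGI, hGlim⟩
  -- the generic criterion
  exact ae_condExpKernel_trivial_of_tendsto (Q := Q) (m := 𝓘.1) 𝓘.2
    (p := fun B : Set (RootedHardCoreConfig (EuclideanSpace ℝ (Fin 3)) δ) =>
      ∀ (S : RootedHardCoreConfig (EuclideanSpace ℝ (Fin 3)) δ) (y : EuclideanSpace ℝ (Fin 3))
        (hy : y ∈ ((S.1 : LocalConfig (EuclideanSpace ℝ (Fin 3))) : Set (EuclideanSpace ℝ (Fin 3)))),
        S ∈ B ↔ S.reroot y hy ∈ B)
    hmiff (c := fun j : ℕ => d (e j)) (fun j => hdm (e j)) hgen' hpi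
    (u := fun j n => birkhoffAverage ℝ A _root_.id n ((d (e j)).indicator fun _ => (1 : ℝ))) hu
    (v := v) hvI hvlim hloc

/-- **Step D5 (`hErg`) in the binder shape of `…ErgodicAssembly.ergodicReduction_of_aeErgodic`.**  For every
`δ > 0`, every probability law `Q` on rooted `δ`-hard-core configurations with Campbell measure invariant under
re-rooting, and the σ-algebra `𝓘` of measurable re-rooting-invariant sets: `Q`-a.e. conditional law
`condExpKernel Q 𝓘 ω` is trivial on every measurable re-rooting-invariant set. [folklore] -/
theorem aeErgodic_condExpKernel_hErg :
    ∀ δ : ℝ, ∀ hδ : 0 < δ, ∀ (Q : MeasureTheory.Measure (Literature.Probability.Process.LocalConfig.RootedHardCoreConfig (EuclideanSpace ℝ (Fin 3)) δ)) [MeasureTheory.IsProbabilityMeasure Q], haveI : Fact (0 < δ) := ⟨hδ⟩; (haveI := Summit.AtomisticToContinuum.Crystallization.Theorems.BenjaminiSchrammLimit.isSFiniteKernel_toMeasure (E := EuclideanSpace ℝ (Fin 3)) (δ := δ); (Q ⊗ₘ (⟨fun S : Literature.Probability.Process.LocalConfig.RootedHardCoreConfig (EuclideanSpace ℝ (Fin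 3)) δ => (S.1 : Literature.Probability.Process.LocalConfig (EuclideanSpace ℝ (Fin 3))).toMeasure, Literature.Probability.Process.LocalConfig.measurable_toMeasure (Fact.out : 0 < δ)⟩ : ProbabilityTheory.Kernel (Literature.Probability.Process.LocalConfig.RootedHardCoreConfig (EuclideanSpace ℝ (Fin 3)) δ) (EuclideanSpace ℝ (Fin 3)))).map (fun p : Literature.Probability.Process.LocalConfig.RootedHardCoreConfig (EuclideanSpace ℝ (Fin 3)) δ × EuclideanSpace ℝ (Fin 3) => ((if h : p.2 ∈ ((p.1.1 : Literature.Probability.Process.LocalConfig (EuclideanSpace ℝ (Fin 3))) : Set (EuclideanSpace ℝ (Fin 3))) then p.1.reroot p.2 h else p.1 : Literature.Probability.Process.LocalConfig.RootedHardCoreConfig (EuclideanSpace ℝ (Fin 3)) δ), -p.2)) = Q ⊗ₘ (⟨fun S : Literature.Probability.Process.LocalConfig.RootedHardCoreConfig (EuclideanSpace ℝ (Fin 3)) δ => (S.1 : Literature.Probability.Process.LocalConfig (EuclideanSpace ℝ (Fin 3))).toMeasure, Literature.Probability.Process.LocalConfig.measurable_toMeasure (Fact.out : 0 < δ)⟩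 : ProbabilityTheory.Kernel (Literature.Probability.Process.LocalConfig.RootedHardCoreConfig (EuclideanSpace ℝ (Fin 3)) δ) (EuclideanSpace ℝ (Fin 3)))) → ∀ 𝓘 : {m : MeasurableSpace (Literature.Probability.Process.LocalConfig.RootedHardCoreConfig (EuclideanSpace ℝ (Fin 3)) δ) // m ≤ (Subtype.instMeasurableSpace : MeasurableSpace (Literature.Probability.Process.LocalConfig.RootedHardCoreConfig (EuclideanSpace ℝ (Fin 3)) δ))}, (∀ B : Set (Literature.Probability.Process.LocalConfig.RootedHardCoreConfig (EuclideanSpace ℝ (Fin 3)) δ), MeasurableSet[𝓘.1] B ↔ (MeasurableSet B ∧ (∀ (S : Literature.Probability.Process.LocalConfig.RootedHardCoreConfig (EuclideanSpace ℝ (Fin 3)) δ) (y : EuclideanSpace ℝ (Fin 3)) (hy : y ∈ ((S.1 : Literature.Probability.Process.LocalConfig (EuclideanSpace ℝ (Fin 3))) : Set (EuclideanSpace ℝ (Fin 3)))), S ∈ B ↔ S.reroot y hy ∈ B))) → ∀ᵐ ω ∂Q, ∀ B : Set (Literature.Probability.Process.LocalConfig.RootedHardCoreConfig (EuclideanSpace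 ℝ (Fin 3)) δ), MeasurableSet B → (∀ (S : Literature.Probability.Process.LocalConfig.RootedHardCoreConfig (EuclideanSpace ℝ (Fin 3)) δ) (y : EuclideanSpace ℝ (Fin 3)) (hy : y ∈ ((S.1 : Literature.Probability.Process.LocalConfig (EuclideanSpace ℝ (Fin 3))) : Set (EuclideanSpace ℝ (Fin 3)))), S ∈ B ↔ S.reroot y hy ∈ B) → ProbabilityTheory.condExpKernel Q 𝓘.1 ω B = 0 ∨ ProbabilityTheory.condExpKernel Q 𝓘.1 ω Bᶜ = 0 := by
  intro δ hδ Q _ hinv 𝓘 hmiff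
  haveI : Fact (0 < δ) := ⟨hδ⟩
  exact ae_ergodic_condExpKernel hinv 𝓘 hmiff

end Summit.AtomisticToContinuum.Crystallization.Theorems.FrustratedLawDichotomyErgodicReduction

end
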